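import Mathlib

/-!
# Stub `stub_thresholdIntegerWeights` of line `width-threshold-certificate-sparsity`
(crux `CliqueExtLowerBound`, stmt-PneNP-10682)

Muroga's theorem (1971), crude form: a non-negatively weighted REAL threshold function of `n`
Boolean variables `v ↦ [h ≤ ∑ⱼ βⱼ vⱼ]` equals a threshold function with non-negative INTEGER
weights and threshold, all at most `(n+2)!` (we even get `(n+1)!`).

Proof. If every point is accepted take `w = 0, t = 0`. Otherwise the realisation polyhedron
`{(w,t) : w ≥ 0, w·a - t ≥ 0 (a accepted), t - w·b ≥ 1 (b rejected)} ⊆ ℝⁿ⁺¹` is nonempty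
(`(β, h) / γ`, `γ` the least rejection margin). Its constraints have normals in `{-1,0,1}ⁿ⁺¹`
and right-hand sides in `{0,1}`, and the normals span `ℝⁿ⁺¹`. A rank-increasing walk (`walk`:
move along a direction orthogonal to the current linearly independent tight normals — it exists by
a dimension count, `exists_orth` — until a new constraint becomes tight, `step`, minimum-ratio
rule) reaches a feasible point `x` with `n+1` linearly independent tight constraints `M x = r`.
By Cramer, `det M • x = cramer M r` is an integer vector whose entries are determinants of
`{-1,0,1}`-matrices, hence at most `(n+1)!` in absolute value (`Matrix.det_le`), and
`|det M| • x` realises the same threshold function with natural-number coordinates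
(`cramer_integral`, `vertex_integral`). The file declares no definitions: the generic lemmas take
the constraint data as arguments and the main proof instantiates them.
-/

set_option linter.dupNamespace false

open Finset Matrix

noncomputable section

namespace Summit.PneNP.PneNP.Theorems.CliqueExtLowerBound.WidthThreshold.IntegerWeights

variable {n : ℕ}

/-- A nonzero vector orthogonal to fewer than `d` given vectors of `ℝᵈ` (dimension count). -/
theorem exists_orth {m d : ℕ} (hm : m < d) (u : Fin m → Fin d → ℝ) :
    ∃ y : Fin d → ℝ, y ≠ 0 ∧ ∀ i, u i ⬝ᵥ y = 0 := by
  have hnot : ¬ Function.Injective (Matrix.of u).mulVecLin := fun hinj => by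
    have := LinearMap.finrank_le_finrank_of_injective hinj
    simp only [Module.finrank_fin_fun] at this
    omega
  obtain ⟨y, hy, hy0⟩ : ∃ y, (Matrix.of u).mulVecLin y = 0 ∧ y ≠ 0 := by
    by_contra! H
    exact hnot ((injective_iff_map_eq_zero _).2 H)
  exact ⟨y, hy0, fun i => by simpa [Matrix.mulVec, dotProduct] using congrFun hy i⟩

/-- Linear combinations are orthogonal to whatever the generators are orthogonal to. -/
theorem sum_smul_dotProduct {m : ℕ} (c : Fin m → ℝ) (u : Fin m → Fin (n + 1) → ℝ)
    (d : Fin (n + 1) → ℝ) : (∑ i, c i • u i) ⬝ᵥ d = ∑ i, c i * (u i ⬝ᵥ d) := by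
  rw [sum_dotProduct]
  simp [smul_dotProduct]

/-- One step of the vertex walk in the polyhedron `{x : ∀ k, r k ≤ ⟨a k, x⟩}`: from a feasible
point with `m` linearly independent tight constraints, a direction `d` orthogonal to them and a
constraint decreasing along `d`, reach a feasible point with `m+1` linearly independent tight
constraints (minimum-ratio rule). -/
theorem step {K : Type*} [Fintype K] (a : K → Fin (n + 1) → ℝ) (r : K → ℝ) {m : ℕ}
    {x : Fin (n + 1) → ℝ} (hx : ∀ k, r k ≤ a k ⬝ᵥ x) {f : Fin m → K}
    (hli : LinearIndependent ℝ (fun i => a (f i))) (ht : ∀ i, a (f i) ⬝ᵥ x = r (f i))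
    {d : Fin (n + 1) → ℝ} (hd : ∀ i, a (f i) ⬝ᵥ d = 0) {k₀ : K} (hk₀ : a k₀ ⬝ᵥ d < 0) :
    ∃ x' : Fin (n + 1) → ℝ, (∀ k, r k ≤ a k ⬝ᵥ x') ∧ ∃ f' : Fin (m + 1) → K,
      LinearIndependent ℝ (fun i => a (f' i)) ∧ ∀ i, a (f' i) ⬝ᵥ x' = r (f' i) := by
  obtain ⟨k₁, hk₁S, hmin⟩ := (univ.filter (fun k => a k ⬝ᵥ d < 0)).exists_min_image
    (fun k => (a k ⬝ᵥ x - r k) / (-(a k ⬝ᵥ d))) ⟨k₀, by simpa using hk₀⟩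
  have hk₁ : a k₁ ⬝ᵥ d < 0 := by simpa using hk₁S
  obtain ⟨lam, hlam⟩ : ∃ lam, lam = (a k₁ ⬝ᵥ x - r k₁) / (-(a k₁ ⬝ᵥ d)) := ⟨_, rfl⟩
  have hlam0 : 0 ≤ lam := hlam ▸ div_nonneg (by linarith [hx k₁]) (by linarith)
  have hlin : ∀ k, a k ⬝ᵥ (x + lam • d) = a k ⬝ᵥ x + lam * (a k ⬝ᵥ d) := fun k => by
    rw [dotProduct_add, dotProduct_smul, smul_eq_mul]
  refine ⟨x + lam • d, fun k => ?_, Fin.cons k₁ f, ?_, ?_⟩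
  · rw [hlin]
    by_cases hk : a k ⬝ᵥ d < 0
    · have h1 : lam ≤ (a k ⬝ᵥ x - r k) / (-(a k ⬝ᵥ d)) := hlam ▸ hmin k (by simpa using hk)
      rw [le_div_iff₀ (by linarith)] at h1
      linarith
    · push Not at hk
      nlinarith [hx k, mul_nonneg hlam0 hk]
  · have hcons : (fun i => a ((Fin.cons k₁ f : Fin (m + 1) → K) i)) =
        Fin.cons (a k₁) (fun i => a (f i)) := by
      funext i
      cases i using Fin.cases with
      | zero => simp
      | succ i => simp
    rw [hcons]
    refine hli.finCons fun hmem => ?_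
    rw [Submodule.mem_span_range_iff_exists_fun] at hmem
    obtain ⟨c, hc⟩ := hmem
    have h0 : a k₁ ⬝ᵥ d = 0 := by
      rw [← hc, sum_smul_dotProduct]
      simp [hd]
    linarith
  · intro i
    cases i using Fin.cases with
    | zero =>
      simp only [Fin.cons_zero]
      rw [hlin, hlam, div_mul_eq_mul_div, mul_div_assoc, div_neg, div_self hk₁.ne]
      ring
    | succ i =>
      simp only [Fin.cons_succ]
      rw [hlin, ht i, hd i]
      ring

/-- The vertex walk: if the normals `a k` span `ℝⁿ⁺¹` (no nonzero vector is orthogonal to all of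
them) and the polyhedron `{x : ∀ k, r k ≤ ⟨a k, x⟩}` is nonempty, then for every `m ≤ n+1` some
feasible point has `m` linearly independent tight constraints. -/
theorem walk {K : Type*} [Fintype K] (a : K → Fin (n + 1) → ℝ) (r : K → ℝ)
    (hspan : ∀ d : Fin (n + 1) → ℝ, d ≠ 0 → ∃ k, a k ⬝ᵥ d ≠ 0)
    {x₀ : Fin (n + 1) → ℝ} (hx₀ : ∀ k, r k ≤ a k ⬝ᵥ x₀) :
    ∀ m, m ≤ n + 1 → ∃ x : Fin (n + 1) → ℝ, (∀ k, r k ≤ a k ⬝ᵥ x) ∧ ∃ f : Fin m → K,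
      LinearIndependent ℝ (fun i => a (f i)) ∧ ∀ i, a (f i) ⬝ᵥ x = r (f i)
  | 0, _ => ⟨x₀, hx₀, Fin.elim0, linearIndependent_empty_type, fun i => i.elim0⟩
  | m + 1, hm => by
    obtain ⟨x, hx, f, hli, ht⟩ := walk a r hspan hx₀ m (by omega)
    obtain ⟨d, hd0, hd⟩ := exists_orth (by omega : m < n + 1) (fun i => a (f i))
    obtain ⟨k, hk⟩ := hspan d hd0
    rcases lt_or_gt_of_ne hk with hlt | hgt
    · exact step a r hx hli ht hd hlt
    · exact step a r hx hli ht (d := -d) (fun i => by simp [hd i]) (k₀ := k)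
        (by simp only [dotProduct_neg]; linarith)

/-- Cramer step: a nonsingular `{-1,0,1}` integer square system `A x = r` with `r ∈ {-1,0,1}` and
a non-negative real solution `x` has `|det A| • x` a vector of natural numbers `≤ (card)!`
(`Matrix.mulVec_cramer`, `Matrix.cramer_apply`, `Matrix.det_le`). -/
theorem cramer_integral {p : Type*} [Fintype p] [DecidableEq p] (A : Matrix p p ℤ) (r : p → ℤ)
    (hA : ∀ i j, |A i j| ≤ 1) (hr : ∀ i, |r i| ≤ 1) (x : p → ℝ) (hx0 : ∀ j, 0 ≤ x j)
    (hli : LinearIndependent ℝ (A.map (Int.cast : ℤ → ℝ)).row)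
    (hx : ∀ i, ∑ j, (A i j : ℝ) * x j = r i) :
    ∃ (D : ℝ) (z : p → ℕ), 0 < D ∧ (∀ j, z j ≤ (Fintype.card p).factorial) ∧
      ∀ j, (z j : ℝ) = D * x j := by
  have hU : IsUnit (A.map (Int.cast : ℤ → ℝ)) := Matrix.linearIndependent_rows_iff_isUnit.1 hli
  have hdetR : (A.det : ℝ) = (A.map (Int.cast : ℤ → ℝ)).det := Int.cast_det A
  have hdet0 : (A.det : ℝ) ≠ 0 :=
    hdetR ▸ ((Matrix.isUnit_iff_isUnit_det _).1 hU).ne_zero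
  have hAx : (A.map (Int.cast : ℤ → ℝ)) *ᵥ x = fun i => (r i : ℝ) :=
    funext fun i => by simpa [Matrix.mulVec, dotProduct] using hx i
  have hc : (A.map (Int.cast : ℤ → ℝ)) *ᵥ (fun j => (A.cramer r j : ℝ)) =
      (A.map (Int.cast : ℤ → ℝ)) *ᵥ ((A.det : ℝ) • x) := by
    rw [Matrix.mulVec_smul, hAx]
    funext i
    have h1 := congrFun (Matrix.mulVec_cramer A r) i
    have h2 : (((A *ᵥ A.cramer r) i : ℤ) : ℝ) = (((A.det • r) i : ℤ) : ℝ) := by rw [h1]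
    simp only [Matrix.mulVec, dotProduct, Pi.smul_apply, smul_eq_mul, Int.cast_mul, Int.cast_sum,
      Matrix.map_apply] at h2 ⊢
    exact h2
  have hinj := (Matrix.mulVec_injective_iff_isUnit.2 hU) hc
  refine ⟨|(A.det : ℝ)|, fun j => (A.cramer r j).natAbs, abs_pos.2 hdet0, fun j => ?_, fun j => ?_⟩
  · have h1 : |(A.updateCol j r).det| ≤ ((Fintype.card p).factorial : ℤ) := by
      have h2 := Matrix.det_le (A := A.updateCol j r) (abv := AbsoluteValue.abs) (x := (1 : ℤ))
        (fun i j' => by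
          rw [AbsoluteValue.abs_apply, Matrix.updateCol_apply]
          split_ifs
          · exact hr i
          · exact hA i j')
      simpa using h2
    rw [← Matrix.cramer_apply] at h1
    have h3 : ((A.cramer r j).natAbs : ℤ) ≤ (Fintype.card p).factorial := by
      rw [Int.natCast_natAbs]; exact h1
    exact_mod_cast h3
  · have h1 : ((A.cramer r j : ℤ) : ℝ) = A.det * x j := by
      simpa using congrFun hinj j
    rw [Nat.cast_natAbs, Int.cast_abs, h1, abs_mul, abs_of_nonneg (hx0 j)]

/-- Vertex + Cramer: for a system with integer normals `aZ k ∈ {-1,0,1}ⁿ⁺¹` spanning `ℝⁿ⁺¹` and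
right-hand sides `rZ k ∈ {-1,0,1}`, whose (nonempty) polyhedron `{x : ∀ k, rZ k ≤ ⟨aZ k, x⟩}` lies
in the non-negative orthant, some feasible `x` has `D • x ∈ ℕⁿ⁺¹` with entries `≤ (n+1)!` for
some real `D > 0`. -/
theorem vertex_integral {K : Type*} [Fintype K] (aZ : K → Fin (n + 1) → ℤ) (rZ : K → ℤ)
    (haZ : ∀ k i, |aZ k i| ≤ 1) (hrZ : ∀ k, |rZ k| ≤ 1)
    (hspan : ∀ d : Fin (n + 1) → ℝ, d ≠ 0 → ∃ k, (fun i => (aZ k i : ℝ)) ⬝ᵥ d ≠ 0)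
    (hpos : ∀ x : Fin (n + 1) → ℝ, (∀ k, (rZ k : ℝ) ≤ (fun i => (aZ k i : ℝ)) ⬝ᵥ x) →
      ∀ i, 0 ≤ x i)
    {x₀ : Fin (n + 1) → ℝ} (hx₀ : ∀ k, (rZ k : ℝ) ≤ (fun i => (aZ k i : ℝ)) ⬝ᵥ x₀) :
    ∃ (x : Fin (n + 1) → ℝ) (D : ℝ) (z : Fin (n + 1) → ℕ),
      (∀ k, (rZ k : ℝ) ≤ (fun i => (aZ k i : ℝ)) ⬝ᵥ x) ∧ 0 < D ∧
      (∀ i, z i ≤ (n + 1).factorial) ∧ ∀ i, (z i : ℝ) = D * x i := by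
  obtain ⟨x, hx, f, hli, ht⟩ :=
    walk (fun k i => (aZ k i : ℝ)) (fun k => (rZ k : ℝ)) hspan hx₀ (n + 1) le_rfl
  obtain ⟨D, z, hD, hzb, hzD⟩ := cramer_integral (fun i j => aZ (f i) j) (fun i => rZ (f i))
    (fun i j => haZ _ _) (fun i => hrZ _) x (hpos x hx) hli (fun i => by simpa [dotProduct] using ht i)
  exact ⟨x, D, z, hx, hD, fun i => by simpa [Fintype.card_fin] using hzb i, hzD⟩

/-- The vector `(1_v, -1)` against `x` gives `∑ⱼ xⱼ [vⱼ] - x_last`. -/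
theorem snoc_ind_sum (v : Fin n → Bool) (x : Fin (n + 1) → ℝ) :
    ∑ i, ((Fin.snoc (fun j => if v j then (1 : ℤ) else 0) (-1 : ℤ) : Fin (n + 1) → ℤ) i : ℝ) * x i =
      (∑ j, x (Fin.castSucc j) * (if v j then 1 else 0)) - x (Fin.last n) := by
  rw [Fin.sum_univ_castSucc]
  simp only [Fin.snoc_castSucc, Fin.snoc_last, Int.cast_neg, Int.cast_one, neg_one_mul,
    ← sub_eq_add_neg]
  congr 1
  refine Finset.sum_congr rfl fun j _ => ?_
  push_cast
  ring

/-- Entries of `(1_v, -1)` are in `{-1,0,1}`. -/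
theorem abs_snoc_ind_le (v : Fin n → Bool) (i : Fin (n + 1)) :
    |(Fin.snoc (fun j => if v j then (1 : ℤ) else 0) (-1 : ℤ) : Fin (n + 1) → ℤ) i| ≤ 1 := by
  cases i using Fin.lastCases with
  | last => simp
  | cast j => by_cases hv : v j <;> simp [hv]

/-- Muroga's theorem (1971, Thm. 9.3.2.1; crude form): every non-negatively weighted real threshold
function of `n` Boolean variables equals a threshold function with non-negative INTEGER weights
and threshold, all at most `(n+2)!`. [folklore] -/
theorem stub_thresholdIntegerWeights : ∀ (n : ℕ) (β : Fin n → ℝ) (h : ℝ), (∀ j, 0 ≤ β j) →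
    ∃ (w : Fin n → ℕ) (t : ℕ), (∀ j, w j ≤ (n + 2).factorial) ∧ t ≤ (n + 2).factorial ∧
      ∀ v : Fin n → Bool, (h ≤ ∑ j, β j * (if v j then (1 : ℝ) else 0)) ↔
        (t ≤ ∑ j, w j * (if v j then 1 else 0)) := by
  intro n β θ hβ
  obtain ⟨S, hS⟩ : ∃ S : (Fin n → Bool) → ℝ, S = fun v => ∑ j, β j * (if v j then 1 else 0) :=
    ⟨_, rfl⟩
  have hSv : ∀ v, (∑ j, β j * (if v j then (1 : ℝ) else 0)) = S v := fun v => by rw [hS]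
  simp only [hSv]
  by_cases hall : ∀ v, θ ≤ S v
  · refine ⟨fun _ => 0, 0, fun _ => Nat.zero_le _, Nat.zero_le _, fun v => ?_⟩
    simp only [zero_mul, Finset.sum_const_zero, le_refl, iff_true]
    exact hall v
  push Not at hall
  obtain ⟨b₀, hb₀⟩ := hall
  -- `T v x = ∑ⱼ xⱼ [vⱼ] - x_last`
  obtain ⟨T, hT⟩ : ∃ T : (Fin n → Bool) → (Fin (n + 1) → ℝ) → ℝ,
      T = fun v x => (∑ j, x (Fin.castSucc j) * (if v j then 1 else 0)) - x (Fin.last n) :=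
    ⟨_, rfl⟩
  -- integer normals and right-hand sides, indexed by `Fin n ⊕ (accepted ⊕ rejected)`
  obtain ⟨aZ, haZ⟩ : ∃ aZ : Fin n ⊕ ({v : Fin n → Bool // θ ≤ S v} ⊕
      {v : Fin n → Bool // ¬ θ ≤ S v}) → Fin (n + 1) → ℤ,
      aZ = Sum.elim (fun j i => if i = Fin.castSucc j then 1 else 0)
        (Sum.elim (fun a => Fin.snoc (fun j => if a.1 j then (1 : ℤ) else 0) (-1))
          (fun b => -Fin.snoc (fun j => if b.1 j then (1 : ℤ) else 0) (-1))) := ⟨_, rfl⟩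
  obtain ⟨rZ, hrZ⟩ : ∃ rZ : Fin n ⊕ ({v : Fin n → Bool // θ ≤ S v} ⊕
      {v : Fin n → Bool // ¬ θ ≤ S v}) → ℤ,
      rZ = Sum.elim (fun _ => 0) (Sum.elim (fun _ => 0) (fun _ => 1)) := ⟨_, rfl⟩
  have hev₁ : ∀ j (x : Fin (n + 1) → ℝ), (fun i => (aZ (Sum.inl j) i : ℝ)) ⬝ᵥ x =
      x (Fin.castSucc j) := by
    intro j x
    simp [haZ, dotProduct]
  have hev₂ : ∀ a (x : Fin (n + 1) → ℝ), (fun i => (aZ (Sum.inr (Sum.inl a)) i : ℝ)) ⬝ᵥ x =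
      T a.1 x := by
    intro a x
    simp only [haZ, hT, Sum.elim_inr, Sum.elim_inl, dotProduct]
    exact snoc_ind_sum a.1 x
  have hev₃ : ∀ b (x : Fin (n + 1) → ℝ), (fun i => (aZ (Sum.inr (Sum.inr b)) i : ℝ)) ⬝ᵥ x =
      -T b.1 x := by
    intro b x
    simp only [haZ, hT, Sum.elim_inr, dotProduct, Pi.neg_apply, Int.cast_neg, neg_mul,
      Finset.sum_neg_distrib]
    rw [snoc_ind_sum]
  have hr₁ : ∀ j, (rZ (Sum.inl j) : ℝ) = 0 := fun j => by simp [hrZ]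
  have hr₂ : ∀ a, (rZ (Sum.inr (Sum.inl a)) : ℝ) = 0 := fun a => by simp [hrZ]
  have hr₃ : ∀ b, (rZ (Sum.inr (Sum.inr b)) : ℝ) = 1 := fun b => by simp [hrZ]
  have hTsum : ∀ (v : Fin n → Bool) (x : Fin (n + 1) → ℝ), (∀ j, 0 ≤ x (Fin.castSucc j)) →
      0 ≤ ∑ j, x (Fin.castSucc j) * (if v j then (1 : ℝ) else 0) := fun v x hx =>
    Finset.sum_nonneg fun j _ => mul_nonneg (hx j) (by split_ifs <;> norm_num)
  -- feasible points have non-negative coordinates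
  have hpos : ∀ x : Fin (n + 1) → ℝ, (∀ k, (rZ k : ℝ) ≤ (fun i => (aZ k i : ℝ)) ⬝ᵥ x) →
      ∀ i, 0 ≤ x i := by
    intro x hx
    have h1 : ∀ j, 0 ≤ x (Fin.castSucc j) := fun j => by
      have h2 := hx (Sum.inl j)
      rwa [hr₁, hev₁] at h2
    intro i
    cases i using Fin.lastCases with
    | cast j => exact h1 j
    | last =>
      have h2 := hx (Sum.inr (Sum.inr ⟨b₀, not_le.2 hb₀⟩))
      simp only [hr₃, hev₃, hT] at h2
      have h3 := hTsum b₀ x h1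
      linarith
  -- the normals span
  have hspan : ∀ d : Fin (n + 1) → ℝ, d ≠ 0 → ∃ k, (fun i => (aZ k i : ℝ)) ⬝ᵥ d ≠ 0 := by
    intro d hd
    by_contra! H
    apply hd
    have h1 : ∀ j, d (Fin.castSucc j) = 0 := fun j => by rw [← hev₁ j d]; exact H _
    have h2 : d (Fin.last n) = 0 := by
      have h3 := H (Sum.inr (Sum.inr ⟨b₀, not_le.2 hb₀⟩))
      simp only [hev₃, hT, h1, zero_mul, Finset.sum_const_zero] at h3
      linarith
    funext i
    cases i using Fin.lastCases with
    | last => simpa using h2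
    | cast j => simpa using h1 j
  -- entries in `{-1,0,1}`
  have habs : ∀ k i, |aZ k i| ≤ 1 := by
    rintro (j | a | b) i
    · by_cases hi : i = Fin.castSucc j <;> simp [haZ, hi]
    · simpa [haZ] using abs_snoc_ind_le a.1 i
    · simpa [haZ] using abs_snoc_ind_le b.1 i
  have hrabs : ∀ k, |rZ k| ≤ 1 := by
    rintro (j | a | b) <;> simp [hrZ]
  -- a feasible starting point `(β, θ) / γ`
  obtain ⟨b₁, hb₁, hmin⟩ := (univ.filter (fun b => S b < θ)).exists_min_image
    (fun b => θ - S b) ⟨b₀, by simpa using hb₀⟩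
  have hb₁' : S b₁ < θ := by simpa using hb₁
  obtain ⟨γ, hγ⟩ : ∃ γ, γ = θ - S b₁ := ⟨_, rfl⟩
  have hγ0 : 0 < γ := by rw [hγ]; linarith
  have hTx₀ : ∀ v, T v (Fin.snoc (fun j => β j / γ) (θ / γ)) = S v / γ - θ / γ := by
    intro v
    simp only [hT, Fin.snoc_castSucc, Fin.snoc_last, hS, Finset.sum_div]
    congr 1
    refine Finset.sum_congr rfl fun j _ => ?_
    ring
  have hx₀ : ∀ k, (rZ k : ℝ) ≤ (fun i => (aZ k i : ℝ)) ⬝ᵥ (Fin.snoc (fun j => β j / γ) (θ / γ)) := by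
    rintro (j | a | b)
    · simp only [hr₁, hev₁, Fin.snoc_castSucc]
      exact div_nonneg (hβ j) hγ0.le
    · rw [hr₂, hev₂, hTx₀, ← sub_div]
      exact div_nonneg (by linarith [a.2]) hγ0.le
    · rw [hr₃, hev₃, hTx₀]
      have h1 : θ - S b₁ ≤ θ - S b.1 := hmin b.1 (by simpa using not_le.1 b.2)
      have h2 : 1 ≤ (θ - S b.1) / γ := by rw [le_div_iff₀ hγ0]; linarith
      rw [sub_div] at h2
      linarith
  -- the vertex and its integral multiple
  obtain ⟨x, D, z, hx, hD, hzb, hzD⟩ := vertex_integral aZ rZ habs hrabs hspan hpos hx₀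
  have hfac : (n + 1).factorial ≤ (n + 2).factorial := Nat.factorial_le (by omega)
  refine ⟨fun j => z (Fin.castSucc j), z (Fin.last n), fun j => (hzb _).trans hfac,
    (hzb _).trans hfac, fun v => ?_⟩
  have hcast : (z (Fin.last n) ≤ ∑ j, z (Fin.castSucc j) * (if v j then 1 else 0)) ↔
      ((z (Fin.last n) : ℝ) ≤ ∑ j, (z (Fin.castSucc j) : ℝ) * (if v j then 1 else 0)) := by
    rw [← Nat.cast_le (α := ℝ)]
    push_cast
    exact Iff.rfl
  have hws : (∑ j, (z (Fin.castSucc j) : ℝ) * (if v j then 1 else 0)) =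
      D * ∑ j, x (Fin.castSucc j) * (if v j then 1 else 0) := by
    simp only [hzD, Finset.mul_sum, mul_assoc]
  rw [hcast, hws, hzD]
  by_cases hv : θ ≤ S v
  · have h1 := hx (Sum.inr (Sum.inl ⟨v, hv⟩))
    simp only [hr₂, hev₂, hT] at h1
    exact ⟨fun _ => mul_le_mul_of_nonneg_left (by linarith) hD.le, fun _ => hv⟩
  · have h1 := hx (Sum.inr (Sum.inr ⟨v, hv⟩))
    simp only [hr₃, hev₃, hT] at h1
    refine ⟨fun h2 => absurd h2 hv, fun h2 => ?_⟩
    have h3 : D * ∑ j, x (Fin.castSucc j) * (if v j then (1 : ℝ) else 0) < D * x (Fin.last n) :=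
      mul_lt_mul_of_pos_left (by linarith) hD
    linarith

end Summit.PneNP.PneNP.Theorems.CliqueExtLowerBound.WidthThreshold.IntegerWeights
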